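import Literature.Claims.NS.ClayVariants
import Literature.Analysis.FluidPDE.ClassicalSolution
import Literature.Analysis.FluidPDE.VectorCalculus
import HarnessLib

/-!
# Claim skeleton C14 `Lam2019` — F. Lam, «The Navier–Stokes equations in primitive variables»,
# arXiv:1903.12098 v3 (2021), §8 «Vorticity bounds» (REGULARITY assertion only; lead ruling)

DISPUTED CLAIM under adjudication (cell `ns-claims`, D-0090; typist `ns-claims-typist-4`, refuter
`ns-claims-refuter-7`, referee `ns-claims-ref-2`). **Nothing in this file asserts a step**: the claimed
statement and every step are `Prop`-valued definitions; the theorems are the kernel composition and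
the Clay link. Bib key `Lam2019NSPrimitive`; text of record arXiv:1903.12098 **v3** (PDF page = printed
page; no theorem environments — claims are prose + numbered displays; `sources/Lam2019/LOCATORS.md`).

## Claimed statement (verbatim)

Abstract p.1: «… we are able to establish long-time regularity of the Cauchy problem for
incompressible flows. A main conclusion is that no events of finite-time blow-up can ever occur in
the Euler or Navier-Stokes equations for initial data of finite energy.» (8.55) p.45: «In summary, we
derive a priori bound |ω|, |∇u| < M₀(u₀) < ∞, (x ∈ ℝ³). These space-wise estimates are effective at
every given instant.» (8.59)–(8.60) p.46: «Finally, we have arrived at the bounds over time (μ ≥ 0):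
u, ω ∈ L^∞(Ω_T) × L²(ℝ³) ∩ C²₀(ℝ³) … ‖ω(x,t)‖_{L^∞(Ω_T)×L^∞(ℝ³)} < ∞.» Setting pp.2–4: (1.1) NS on `ℝ³`
(potential force absorbed in `p`), data (1.3) `u₀ ∈ C_c^∞` solenoidal with Schwartz data admitted
(1.4), finite energy (1.7) on `Ω_T = ℝ³ × [0,T)`, decay (1.8) `u → 0` as `|x| → ∞`, `μ ≥ 0`.

## Clay delta (reference `Literature.Claims.NS.ClayVariants`)

Direction REGULARITY; nearest Clay statement (A) = `ClayVariants.clayR3.Regularity`. Δ1 =; Δ2 = (the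
Euler case `ν = 0` is an extra conjunct: the typed class allows `ν ≥ 0`); Δ3 = (`f ≡ 0`); Δ4 = (Schwartz
admitted); Δ5 classical decaying solutions on slabs `[0,T)` =; **Δ6 conclusion: time-uniform a priori
bounds (8.55)/(8.60) + uniqueness; the passage to (A) is a continuation argument the print does not
state (p.47 prose) — typed as the explicit hypothesis `ClayDelta`**; Δ7 `ν` normalised (harmless).

## Step index (dependency order of §8 = argument order of `claim_of_steps`)

* Step 1 = `Step1_continuity` — «The continuity», display (8.10) p.40: «There is a natural number N₁
  such that |∂u_i/∂x_i| < N₁ Σ_n sup_x |∂u_n(x,t=0)/∂x_n|» (N₁ bound before `t`, data on the right —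
  F11; the reading with `N₁` depending on the solution and `T` is vacuous and is NOT the typed one).
  TYPIST'S PREDICTED FIRST FAILING STEP (CARD §4).
* Step 2 = `Step2_invariance` — (8.14)–(8.17) p.41: `∫ ω(x,t) dx = ∫ ω₀(x) dx` componentwise
  (and (8.51) p.45 for `ν > 0`).
* Step 3 = `Step3_vorticityL1` — (8.18)–(8.19) p.41 with (8.11) p.40: «each of the integrals must be
  bounded … By the Archimedean property for two positive reals, ‖ω‖_{L¹(ℝ³)} < A*₀»,
  `A*₀ = N₂ (‖ξ₀‖_{L¹} + ‖η₀‖_{L¹} + ‖ζ₀‖_{L¹})` (the `β = 0` instance of (8.11)), `N₂` a natural number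
  fixed with the data. Predicted first KERNEL-refutable step (as an inference on functions).
* Step 4 = `Step4_higherL1` — (8.38)–(8.40) pp.43–44 (+ (8.52)–(8.54) p.45): `‖D^α ω(·,t)‖_{L¹} < A*`
  for every multi-index, by the same device applied to `d/dt ∫ D^α ω dx = 0`.
* Step 5 = `Step5_sobolev` — (8.41) p.44: Sobolev embedding, `ω ∈ C²_B(ℝ³)` with a time-uniform bound.
* Step 6 = `Step6_apriori` — (8.55) p.45: `|ω|, |∇u| < M₀(u₀)` for all `x` at every instant (LOAD-BEARING).
* Step 7 = `Step7_enstrophy` — (8.56)–(8.57) p.46: `‖ω(t)‖²_{L²} < ‖ω₀‖²_{L²} e^{2M₀t}` from Step 6's `M₀`.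
* Step 8 = `Step8_uniqueness` — p.46–47 (8.61)–(8.63): uniqueness via `‖∇u‖_∞ < M₀`.

COMPOSITION: `claim_of_steps` (Steps 1–8 ⊢ `ClaimedTheorem`; consumed: Steps 6 and 8). Printed
derivations that are proofs in print: Step 2 ⊢ Step 3 («the last sum is finite and hence each of the
integrals must be bounded»), Steps 3–4 ⊢ Step 5 (embedding), Steps 1, 5 ⊢ Step 6, Step 6 ⊢ Step 7.

## Typing notes

* Solution class `SlabSolution ν T u₀ u p`: `ν ≥ 0`, `T > 0`, Clay data, the tree's classical
  predicate `IsClassicalNSSolutionOn (Ico 0 T) ν 0 u p`, `u 0 = u₀`, and decay (1.8) typed as rapid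
  spatial decay of every slice `u t`, `t ∈ [0,T)` (a class restriction; every ∀-step only weakens).
* `∂u_i/∂x_i` = `diagStrain`; `sup_x` = real `iSup` (finite for Schwartz data); vorticity = tree
  `curl`; `L¹` norms as lower Lebesgue integrals in `ℝ≥0∞` (no Bochner junk); (8.11) typed at `β = 0`
  -- TODO(general form): the `β ≥ 1` summands of (8.11) and the full multi-index family of (8.40).
* Constants: `N₁`, `N₂ : ℕ` and `M₀` are bound BEFORE the solution and the time, depending on the
  datum only («M₀(u₀)», (8.55); «t = 0» data on the right of (8.10); (8.11) fixed «at t = 0»). The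
  strict `<` of (8.10)/(8.19), whose right sides vanish for the trivial flow, is typed `≤` in Steps 1
  and 3 (charitable; the strict form is refuted by `u ≡ 0`, an artefact); (8.55)'s `< M₀` is kept
  (`M₀` is existentially bound).

WHAT THIS IS NOT: not a claim about NS regularity or blow-up; not a claim about any author beyond
the typed locator.
-/

open scoped ContDiff ENNReal
open _root_.MeasureTheory _root_.Set

namespace Literature.Claims.NS.Lam2019

open Literature.Analysis.FluidPDE

noncomputable section

/-! ## Setting -/

/-- A classical decaying solution on the slab `ℝ³ × [0,T)` from Clay data, `ν ≥ 0` (pp.2–4: (1.1),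
(1.3)/(1.4), (1.8); `μ ≥ 0` in (8.59)). [cite: Lam2019NSPrimitive, §1 (1.1)–(1.8) pp.2–3; (8.59) p.46] -/
structure SlabSolution (ν T : ℝ) (u₀ : EuclideanSpace ℝ (Fin 3) → EuclideanSpace ℝ (Fin 3))
    (u : ℝ → EuclideanSpace ℝ (Fin 3) → EuclideanSpace ℝ (Fin 3))
    (p : ℝ → EuclideanSpace ℝ (Fin 3) → ℝ) : Prop where
  /-- `μ ≥ 0` (Euler included). -/
  viscosity_nonneg : 0 ≤ ν
  /-- the slab is nonempty -/
  time_pos : 0 < T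
  /-- data smooth (1.3)/(1.4) -/
  data_smooth : ContDiff ℝ ∞ u₀
  /-- data rapidly decaying (Schwartz admitted, (1.4)) -/
  data_decay : HasRapidSpatialDecay u₀
  /-- data solenoidal -/
  data_divFree : NSWave0.IsDivFree u₀
  /-- classical solution of (1.1) with `f ≡ 0` on `[0,T)` -/
  solution : IsClassicalNSSolutionOn (Ico 0 T) ν 0 u p
  /-- initial condition -/
  initial : u 0 = u₀
  /-- decay (1.8) of every slice (typed as rapid spatial decay) -/
  decay : ∀ t ∈ Ico 0 T, HasRapidSpatialDecay (u t)

/-- The diagonal strain entry `∂u_i/∂x_i (x)`. [cite: Lam2019NSPrimitive, (8.10) p.40] -/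
def diagStrain (v : EuclideanSpace ℝ (Fin 3) → EuclideanSpace ℝ (Fin 3)) (i : Fin 3)
    (x : EuclideanSpace ℝ (Fin 3)) : ℝ :=
  fderiv ℝ v x (EuclideanSpace.single i (1 : ℝ)) i

/-- The data quantity `Σ_n sup_x |∂u_n(x,0)/∂x_n|` of (8.10). [cite: Lam2019NSPrimitive, (8.10) p.40] -/
def dataDiagSup (u₀ : EuclideanSpace ℝ (Fin 3) → EuclideanSpace ℝ (Fin 3)) : ℝ :=
  ∑ n : Fin 3, ⨆ x : EuclideanSpace ℝ (Fin 3), |diagStrain u₀ n x|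

/-- `‖ω‖_{L¹(ℝ³)}` of a field (`ω = curl v`), in `ℝ≥0∞`. [cite: Lam2019NSPrimitive, (8.18)–(8.19) p.41] -/
def vorticityL1 (v : EuclideanSpace ℝ (Fin 3) → EuclideanSpace ℝ (Fin 3)) : ℝ≥0∞ :=
  ∫⁻ x, ‖curl v x‖ₑ

/-- `A*₀ = N₂ (‖ξ₀‖_{L¹} + ‖η₀‖_{L¹} + ‖ζ₀‖_{L¹})` — the `β = 0` instance of (8.11) p.40, `N₂ : ℕ`.
[cite: Lam2019NSPrimitive, (8.11) p.40] -/
def Astar (u₀ : EuclideanSpace ℝ (Fin 3) → EuclideanSpace ℝ (Fin 3)) (N₂ : ℕ) : ℝ≥0∞ :=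
  (N₂ : ℝ≥0∞) * ∑ i : Fin 3, ∫⁻ x, ‖curl u₀ x i‖ₑ

/-! ## The claimed statement -/

/-- **(8.55) p.45 + (8.59)–(8.60) p.46 + uniqueness p.46–47**: for every datum there is `M₀(u₀)` with
`|ω(x,t)|, |∇u(x,t)| < M₀` for every classical decaying solution on any slab `[0,T)`, `ν ≥ 0`, every
`t < T` and `x`; and such solutions are unique. [claim: Lam2019NSPrimitive, status: disputed]
[cite: Lam2019NSPrimitive, (8.55) p.45; (8.59)–(8.60) p.46; «Uniqueness» pp.46–47] -/
def ClaimedTheorem : Prop :=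
  (∀ u₀ : EuclideanSpace ℝ (Fin 3) → EuclideanSpace ℝ (Fin 3), ContDiff ℝ ∞ u₀ →
      HasRapidSpatialDecay u₀ → NSWave0.IsDivFree u₀ →
      ∃ M₀ : ℝ, ∀ (ν T : ℝ) (u : ℝ → EuclideanSpace ℝ (Fin 3) → EuclideanSpace ℝ (Fin 3))
        (p : ℝ → EuclideanSpace ℝ (Fin 3) → ℝ), SlabSolution ν T u₀ u p →
        ∀ t ∈ Ico 0 T, ∀ x : EuclideanSpace ℝ (Fin 3),
          ‖curl (u t) x‖ < M₀ ∧ ‖fderiv ℝ (u t) x‖ < M₀) ∧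
  ∀ (ν T : ℝ) (u₀ : EuclideanSpace ℝ (Fin 3) → EuclideanSpace ℝ (Fin 3))
    (u v : ℝ → EuclideanSpace ℝ (Fin 3) → EuclideanSpace ℝ (Fin 3))
    (p q : ℝ → EuclideanSpace ℝ (Fin 3) → ℝ),
    SlabSolution ν T u₀ u p → SlabSolution ν T u₀ v q → ∀ t ∈ Ico 0 T, u t = v t

/-! ## The steps -/

/-- **Step 1** — «The continuity», (8.10) p.40: «The incompressibility ∇·u₀ = ∇·u = 0 is a finite sum
of three reals. It follows that every ∂u_i/∂x_i must be finite. There is a natural number N₁ such that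
every one of these three derivatives can be bounded |∂u_i/∂x_i| < N₁ Σ_n sup_x |∂u_n(x,t=0)/∂x_n|».
Typed with `N₁` depending on the datum only (bound before the solution, `T`, `t`, `x`); the
print's strict `<` is typed `≤` (charitable: with `<` the display fails for the trivial flow `u ≡ 0`,
whose right side is `0` — an artefact, not the adjudicated content).
[claim: Lam2019NSPrimitive, status: disputed] [cite: Lam2019NSPrimitive, (8.10) p.40] -/
def Step1_continuity : Prop :=
  ∀ u₀ : EuclideanSpace ℝ (Fin 3) → EuclideanSpace ℝ (Fin 3), ContDiff ℝ ∞ u₀ →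
    HasRapidSpatialDecay u₀ → NSWave0.IsDivFree u₀ →
    ∃ N₁ : ℕ, ∀ (ν T : ℝ) (u : ℝ → EuclideanSpace ℝ (Fin 3) → EuclideanSpace ℝ (Fin 3))
      (p : ℝ → EuclideanSpace ℝ (Fin 3) → ℝ), SlabSolution ν T u₀ u p →
      ∀ t ∈ Ico 0 T, ∀ (x : EuclideanSpace ℝ (Fin 3)) (i : Fin 3),
        |diagStrain (u t) i x| ≤ N₁ * dataDiagSup u₀

/-- **Step 2** — (8.14)–(8.17) p.41 (and (8.50)–(8.51) p.45 for `ν > 0`): invariance of the signed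
component integrals, `∫ ω(x,t) dx = ∫ ω₀(x) dx` («the total torque on fluid elements equals zero»).
[claim: Lam2019NSPrimitive, status: disputed] [cite: Lam2019NSPrimitive, (8.17) p.41, (8.51) p.45] -/
def Step2_invariance : Prop :=
  ∀ (ν T : ℝ) (u₀ : EuclideanSpace ℝ (Fin 3) → EuclideanSpace ℝ (Fin 3))
    (u : ℝ → EuclideanSpace ℝ (Fin 3) → EuclideanSpace ℝ (Fin 3)) (p : ℝ → EuclideanSpace ℝ (Fin 3) → ℝ),
    SlabSolution ν T u₀ u p → ∀ t ∈ Ico 0 T, ∀ i : Fin 3,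
      ∫ x, curl (u t) x i = ∫ x, curl u₀ x i

/-- **Step 3** — (8.18)–(8.19) p.41 with (8.11) p.40: «∫ξ dx = ∫max(ξ,0) + ∫min(ξ,0), where the last
sum is finite and hence each of the integrals must be bounded … ω ∈ L¹(ℝ³) (8.18). By the Archimedean
property for two positive reals, ‖ω‖_{L¹(ℝ³)} < A*₀ (8.19)», `A*₀` fixed from the data with a natural
number `N₂` (8.11) — typed `∀ data ∃ N₂ ∀ solutions ∀ t` (F11); the print's strict `<` is typed
`≤` (charitable: excludes the trivial-flow artefact `0 < 0`).
[claim: Lam2019NSPrimitive, status: disputed] [cite: Lam2019NSPrimitive, (8.18)–(8.19) p.41, (8.11) p.40] -/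
def Step3_vorticityL1 : Prop :=
  ∀ u₀ : EuclideanSpace ℝ (Fin 3) → EuclideanSpace ℝ (Fin 3), ContDiff ℝ ∞ u₀ →
    HasRapidSpatialDecay u₀ → NSWave0.IsDivFree u₀ →
    ∃ N₂ : ℕ, ∀ (ν T : ℝ) (u : ℝ → EuclideanSpace ℝ (Fin 3) → EuclideanSpace ℝ (Fin 3))
      (p : ℝ → EuclideanSpace ℝ (Fin 3) → ℝ), SlabSolution ν T u₀ u p →
      ∀ t ∈ Ico 0 T, vorticityL1 (u t) ≤ Astar u₀ N₂

/-- **Step 4** — (8.38)–(8.40) pp.43–44 (+ (8.52)–(8.54) p.45 «without repeating the analysis»):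
`‖D^α ω‖_{L¹(ℝ³)} < A*` for every order, uniformly in time, by the device of Step 3 applied to
`d/dt ∫ D^α ω dx = 0`; typed with the `k`-th Fréchet derivative of `ω(·,t)`.
[claim: Lam2019NSPrimitive, status: disputed] [cite: Lam2019NSPrimitive, (8.38)–(8.40) pp.43–44] -/
def Step4_higherL1 : Prop :=
  ∀ u₀ : EuclideanSpace ℝ (Fin 3) → EuclideanSpace ℝ (Fin 3), ContDiff ℝ ∞ u₀ →
    HasRapidSpatialDecay u₀ → NSWave0.IsDivFree u₀ → ∀ k : ℕ,
    ∃ A : ℝ≥0∞, A < ⊤ ∧ ∀ (ν T : ℝ) (u : ℝ → EuclideanSpace ℝ (Fin 3) → EuclideanSpace ℝ (Fin 3))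
      (p : ℝ → EuclideanSpace ℝ (Fin 3) → ℝ), SlabSolution ν T u₀ u p →
      ∀ t ∈ Ico 0 T, ∫⁻ x, ‖iteratedFDeriv ℝ k (curl (u t)) x‖ₑ < A

/-- **Step 5** — (8.41) p.44: by Sobolev embedding (`W^{k,1}(ℝ³)`, all `k`), `ω ∈ C²_B(ℝ³)` with a
bound uniform in time: typed as a time-uniform sup bound of `ω` and of its first two derivatives.
[claim: Lam2019NSPrimitive, status: disputed] [cite: Lam2019NSPrimitive, (8.41) p.44] -/
def Step5_sobolev : Prop :=
  ∀ u₀ : EuclideanSpace ℝ (Fin 3) → EuclideanSpace ℝ (Fin 3), ContDiff ℝ ∞ u₀ →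
    HasRapidSpatialDecay u₀ → NSWave0.IsDivFree u₀ →
    ∃ M : ℝ, ∀ (ν T : ℝ) (u : ℝ → EuclideanSpace ℝ (Fin 3) → EuclideanSpace ℝ (Fin 3))
      (p : ℝ → EuclideanSpace ℝ (Fin 3) → ℝ), SlabSolution ν T u₀ u p →
      ∀ t ∈ Ico 0 T, ∀ (x : EuclideanSpace ℝ (Fin 3)) (k : ℕ), k ≤ 2 →
        ‖iteratedFDeriv ℝ k (curl (u t)) x‖ ≤ M

/-- **Step 6** — (8.55) p.45 (LOAD-BEARING): «we derive a priori bound |ω|, |∇u| < M₀(u₀) < ∞,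
(x ∈ ℝ³). These space-wise estimates are effective at every given instant.»
[claim: Lam2019NSPrimitive, status: disputed] [cite: Lam2019NSPrimitive, (8.55) p.45] -/
def Step6_apriori : Prop :=
  ∀ u₀ : EuclideanSpace ℝ (Fin 3) → EuclideanSpace ℝ (Fin 3), ContDiff ℝ ∞ u₀ →
    HasRapidSpatialDecay u₀ → NSWave0.IsDivFree u₀ →
    ∃ M₀ : ℝ, ∀ (ν T : ℝ) (u : ℝ → EuclideanSpace ℝ (Fin 3) → EuclideanSpace ℝ (Fin 3))
      (p : ℝ → EuclideanSpace ℝ (Fin 3) → ℝ), SlabSolution ν T u₀ u p →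
      ∀ t ∈ Ico 0 T, ∀ x : EuclideanSpace ℝ (Fin 3), ‖curl (u t) x‖ < M₀ ∧ ‖fderiv ℝ (u t) x‖ < M₀

/-- **Step 7** — (8.56)–(8.57) p.46: with `M₀` of Step 6, `d/dt ‖ω‖²_{L²} < 2M₀‖ω‖²_{L²}`, hence
`‖ω(·,t)‖²_{L²} < ‖ω₀‖²_{L²} e^{2M₀t}` — typed as the implication for the solution at hand.
[claim: Lam2019NSPrimitive, status: disputed] [cite: Lam2019NSPrimitive, (8.56)–(8.57) p.46] -/
def Step7_enstrophy : Prop :=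
  ∀ (ν T : ℝ) (u₀ : EuclideanSpace ℝ (Fin 3) → EuclideanSpace ℝ (Fin 3))
    (u : ℝ → EuclideanSpace ℝ (Fin 3) → EuclideanSpace ℝ (Fin 3)) (p : ℝ → EuclideanSpace ℝ (Fin 3) → ℝ),
    SlabSolution ν T u₀ u p → ∀ M₀ : ℝ,
      (∀ t ∈ Ico 0 T, ∀ x : EuclideanSpace ℝ (Fin 3), ‖fderiv ℝ (u t) x‖ < M₀) →
      ∀ t ∈ Ico 0 T,
        ∫⁻ x, ‖curl (u t) x‖ₑ ^ 2 ≤ ENNReal.ofReal (Real.exp (2 * M₀ * t)) * ∫⁻ x, ‖curl u₀ x‖ₑ ^ 2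

/-- **Step 8** — «Uniqueness» pp.46–47, (8.61)–(8.63): two solutions from the same data coincide
(Gronwall with `‖∇u‖_∞ < M₀`). [claim: Lam2019NSPrimitive, status: disputed]
[cite: Lam2019NSPrimitive, (8.61)–(8.63) pp.46–47] -/
def Step8_uniqueness : Prop :=
  ∀ (ν T : ℝ) (u₀ : EuclideanSpace ℝ (Fin 3) → EuclideanSpace ℝ (Fin 3))
    (u v : ℝ → EuclideanSpace ℝ (Fin 3) → EuclideanSpace ℝ (Fin 3))
    (p q : ℝ → EuclideanSpace ℝ (Fin 3) → ℝ),
    SlabSolution ν T u₀ u p → SlabSolution ν T u₀ v q → ∀ t ∈ Ico 0 T, u t = v t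

/-! ## Kernel composition (pure logic) -/

/-- **COMPOSITION**: Steps 1–8 (dependency order) imply the claimed statement; consumed: Steps 6, 8.
[cite: Lam2019NSPrimitive, §8 pp.38–47] -/
theorem claim_of_steps :
    Step1_continuity → Step2_invariance → Step3_vorticityL1 → Step4_higherL1 → Step5_sobolev →
      Step6_apriori → Step7_enstrophy → Step8_uniqueness → ClaimedTheorem :=
  fun _h1 _h2 _h3 _h4 _h5 h6 _h7 h8 => ⟨h6, h8⟩

/-! ## Clay link (Δ6) -/

/-- **ClayDelta (Δ6, CONTINUATION)** — the hypothesis under which the claimed a priori bound yields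
Clay (A): if every classical decaying solution from a Clay datum at viscosity `ν > 0` obeys a
time-uniform sup bound on its vorticity on every slab, then the datum has a Clay-sense global smooth
bounded-energy solution (local existence + Beale–Kato–Majda continuation + energy; NOT printed —
p.47 prose). NOT asserted here. [claim: Lam2019NSPrimitive, status: disputed]
[cite: Lam2019NSPrimitive, §8(c) p.47 and §9 p.47–48] -/
def ClayDelta : Prop :=
  ∀ ν : ℝ, 0 < ν → ∀ u₀ : EuclideanSpace ℝ (Fin 3) → EuclideanSpace ℝ (Fin 3), ContDiff ℝ ∞ u₀ →
    NSWave0.IsDivFree u₀ → HasRapidSpatialDecay u₀ →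
    (∃ M₀ : ℝ, ∀ (T : ℝ) (u : ℝ → EuclideanSpace ℝ (Fin 3) → EuclideanSpace ℝ (Fin 3))
      (p : ℝ → EuclideanSpace ℝ (Fin 3) → ℝ), SlabSolution ν T u₀ u p →
      ∀ t ∈ Ico 0 T, ∀ x : EuclideanSpace ℝ (Fin 3), ‖curl (u t) x‖ < M₀) →
    ClayVariants.clayR3.Solvable ν 0 u₀

/-- Modulo `ClayDelta`, the claimed theorem gives Clay (A). [cite: Lam2019NSPrimitive, abstract p.1] -/
theorem clay_of_claimed (h : ClaimedTheorem) (hΔ : ClayDelta) : ClayVariants.clayR3.Regularity :=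
  fun ν hν u₀ hsm hdiv hdec =>
    hΔ ν hν u₀ hsm hdiv hdec
      ((h.1 u₀ hsm hdec hdiv).imp fun _M₀ hM T u p hS t ht x => (hM ν T u p hS t ht x).1)

end

end Literature.Claims.NS.Lam2019

-- WHAT THIS IS NOT: not a claim about NS regularity or blow-up; not a claim about any author beyond
-- the typed locator.
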